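import Summits.CriticalPhenomena.CardyFormulaZ2.Theorems.CardyComplexConeParafermionToSLESixFamiliesDiamondTurnCountFrame
import Literature.Probability.LatticeModels.MedialCornerWalkRuns
import HarnessLib

/-!
# The escape staircase of a touch site: the bottom route and the top route around the far box
# (line `potential-darboux-picard-diamond`, S1t `stub_freeSideTurnCount`, part 5)

Crux `ParafermionToSLESixFamilies` (stmt-CriticalPhenomena-11389), line `potential-darboux-picard-diamond`, stub
`stub_freeSideTurnCount` (S1t). From the far corner `v⋆ = (K, -K)` of the box `[-K, K]²` (coordinates `xiC k`, `upC k` of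
`…DiamondTurnCountFrame.lean`) two of the three routes back to the outer corner `p` of the start edge (defined in `…DiamondTurnCountFrame.lean`), each finished by
the gadget steps `gds` from `p` into the start vertex:

* the BOTTOM ROUTE `routeBot k K p gds = W^{K - xiC p} ++ N^{upC p + K} ++ gds` — west along the bottom row to the
  column of `p`, north up that column (used when the column below `p` is outside the diamond: `p` before the touch site
  along its side, or beyond the previous side);
* the TOP ROUTE `routeTop k K p gds = W^{2K} ++ N^{2K} ++ E^{xiC p + K} ++ S^{K - upC p} ++ gds` — west along the bottom
  row, north up the left column, east along the top row to the column of `p`, south down that column (used when the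
  column above `p` is outside: `p` beyond the opposite side).

`routeBot_data` (registered) and `routeTop_data` package their bookkeeping against an abstract indicator `ι` (`0` on
outside sites, `1` on sites of the diamond): first step west, end vertex, last direction, the coordinates of the
vertices, no repeated vertex, the end vertex is new, and `xiC - upC ≤ 2K - 1` off the far corner. The third route is
`…DiamondTurnCountRouteEast.lean`.
-/

noncomputable section

namespace Summit.CriticalPhenomena.CardyFormulaZ2.Cruxes.ParafermionToSLESixFamilies.PotentialDarbouxPicardDiamond

open Literature.Probability Literature.Probability.LatticeModels

/-! ## The bottom route -/

/-- **The bottom route** (registered helper of `stub_freeSideTurnCount`). See the module docstring. -/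
theorem routeBot_data : ∀ (k : Fin 4) (K : ℤ) (ι : Site 2 → ℤ) (vs p : Site 2) (gds : List (Fin 4)), xiC k vs = K → upC k vs = -K → |xiC k p| ≤ K - 2 → |upC k p| ≤ K - 2 → gds ≠ [] → (∀ v ∈ pathVerts p gds, v = p ∨ (ι v = 1 ∧ |xiC k v - xiC k p| ≤ 1 ∧ |upC k v - upC k p| ≤ 1)) → (pathVerts p gds).Nodup → ι p = 0 → (∀ v : Site 2, (xiC k v = K ∨ xiC k v = -K ∨ upC k v = K ∨ upC k v = -K) → ι v = 0) → (∀ v : Site 2, xiC k v = xiC k p → upC k v ≤ upC k p - 1 → ι v = 0) → ι (pathEnd p gds) = 1 → pathEnd p gds ∉ pathVerts p gds → ∃ Qt : List (Fin 4), routeBot k K p gds = (k + 2) :: Qt ∧ pathEnd vs (routeBot k K p gds) = pathEnd p gds ∧ lastDir (routeBot k K p gds) = lastDir gds ∧ (∀ v ∈ pathVerts vs (routeBot k K p gds), (upC k v = -K ∧ xiC k p + 1 ≤ xiC k v ∧ xiC k v ≤ K ∧ ι v = 0) ∨ (xiC k v = xiC k p ∧ -K ≤ upC k v ∧ upC k v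 ≤ upC k p - 1 ∧ ι v = 0) ∨ v ∈ pathVerts p gds) ∧ (pathVerts vs (routeBot k K p gds)).Nodup ∧ pathEnd p gds ∉ pathVerts vs (routeBot k K p gds) ∧ (∀ b ∈ pathVerts vs (routeBot k K p gds), b = vs ∨ xiC k b - upC k b ≤ 2 * K - 1) := by
  intro k K ι vs p gds hvs1 hvs2 hp1 hp2 hgds hgV hgnd hιp hιfar hιsp hx1 hx2
  rw [abs_le] at hp1 hp2
  have hL1 : ((K - xiC k p).toNat : ℤ) = K - xiC k p := Int.toNat_of_nonneg (by omega)
  have hL2 : ((upC k p + K).toNat : ℤ) = upC k p + K := Int.toNat_of_nonneg (by omega)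
  -- the two intermediate corners
  have hc1 : vs + ((K - xiC k p).toNat : ℤ) • cornerUnit (k + 2) + ((upC k p + K).toNat : ℤ) • cornerUnit (k + 1) = p := by
    apply eq_of_xiC_upC (k := k)
    · simp only [xiC_add_smul1, xiC_add_smul2]; omega
    · simp only [upC_add_smul1, upC_add_smul2]; omega
  -- coordinates of the vertices of the two runs
  have hverts : ∀ v ∈ pathVerts vs (routeBot k K p gds),
      (upC k v = -K ∧ xiC k p + 1 ≤ xiC k v ∧ xiC k v ≤ K ∧ ι v = 0) ∨
        (xiC k v = xiC k p ∧ -K ≤ upC k v ∧ upC k v ≤ upC k p - 1 ∧ ι v = 0) ∨ v ∈ pathVerts p gds := by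
    intro v hv
    rw [routeBot, List.append_assoc, mem_pathVerts_replicate_append, mem_pathVerts_replicate_append, hc1] at hv
    rcases hv with ⟨i, hi, h⟩ | ⟨i, hi, h⟩ | h
    · left
      have hx := congrArg (xiC k) h
      have hy := congrArg (upC k) h
      simp only [xiC_add_smul2, upC_add_smul2] at hx hy
      exact ⟨by omega, by omega, by omega, hιfar v (by omega)⟩
    · right; left
      have hx := congrArg (xiC k) h
      have hy := congrArg (upC k) h
      simp only [xiC_add_smul1, xiC_add_smul2, upC_add_smul1, upC_add_smul2] at hx hy
      exact ⟨by omega, by omega, by omega, hιsp v (by omega) (by omega)⟩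
    · exact Or.inr (Or.inr h)
  refine ⟨List.replicate ((K - xiC k p).toNat - 1) (k + 2) ++ List.replicate (upC k p + K).toNat (k + 1) ++ gds,
    ?_, ?_, ?_, hverts, ?_, ?_, ?_⟩
  · -- first step
    have hM : (K - xiC k p).toNat = ((K - xiC k p).toNat - 1) + 1 := by omega
    have hW : List.replicate (K - xiC k p).toNat (k + 2) = (k + 2) :: List.replicate ((K - xiC k p).toNat - 1) (k + 2) := by
      conv_lhs => rw [hM]
      rfl
    rw [routeBot, hW]
    simp
  · -- end vertex
    rw [routeBot, List.append_assoc, pathEnd_replicate_append, pathEnd_replicate_append, hc1]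
  · -- last direction
    rw [routeBot, List.append_assoc, lastDir_append_of_ne_nil _ (List.append_ne_nil_of_right_ne_nil _ hgds),
      lastDir_append_of_ne_nil _ hgds]
  · -- no repeated vertex
    rw [routeBot, List.append_assoc, nodup_pathVerts_replicate_append]
    refine ⟨?_, fun v hv ⟨i, hi, h⟩ => ?_⟩
    · rw [nodup_pathVerts_replicate_append, hc1]
      refine ⟨hgnd, fun v hv ⟨i, hi, h⟩ => ?_⟩
      have hx := congrArg (xiC k) h
      have hy := congrArg (upC k) h
      simp only [xiC_add_smul1, xiC_add_smul2, upC_add_smul1, upC_add_smul2] at hx hy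
      rcases hgV v hv with rfl | ⟨hι, -, -⟩
      · omega
      · have := hιsp v (by omega) (by omega); omega
    · have hx := congrArg (xiC k) h
      have hy := congrArg (upC k) h
      simp only [xiC_add_smul2, upC_add_smul2] at hx hy
      rw [mem_pathVerts_replicate_append, hc1] at hv
      rcases hv with ⟨i', hi', h'⟩ | hv
      · have hx' := congrArg (xiC k) h'
        simp only [xiC_add_smul1, xiC_add_smul2] at hx'
        omega
      · rcases hgV v hv with rfl | ⟨hι, -, -⟩
        · omega
        · have := hιfar v (by omega); omega
  · -- the end vertex is new
    intro h
    rcases hverts _ h with ⟨-, -, -, h0⟩ | ⟨-, -, -, h0⟩ | h0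
    · omega
    · omega
    · exact hx2 h0
  · -- the side functional off the far corner
    intro b hb
    rcases hverts b hb with ⟨h1, h2, h3, -⟩ | ⟨h1, h2, h3, -⟩ | h
    · rcases lt_or_eq_of_le h3 with h3 | h3
      · right; omega
      · left; exact eq_of_xiC_upC (k := k) (by omega) (by omega)
    · right; omega
    · rcases hgV b h with rfl | ⟨-, h4, h5⟩
      · right; omega
      · rw [abs_le] at h4 h5; right; omega

/-! ## The top route -/

section Legs

variable {k : Fin 4} {K : ℤ} {ι : Site 2 → ℤ} {vs p : Site 2} {gds : List (Fin 4)} {n0 n1 n2 : ℕ}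

/-- The end of the four legs is `p`. -/
theorem routeTop_corner_eq (hvs1 : xiC k vs = K) (hvs2 : upC k vs = -K) (hn0 : (n0 : ℤ) = 2 * K)
    (hn1 : (n1 : ℤ) = xiC k p + K) (hn2 : (n2 : ℤ) = K - upC k p) :
    vs + (n0 : ℤ) • cornerUnit (k + 2) + (n0 : ℤ) • cornerUnit (k + 1) + (n1 : ℤ) • cornerUnit k +
      (n2 : ℤ) • cornerUnit (k + 3) = p := by
  apply eq_of_xiC_upC (k := k)
  · simp only [xiC_add_smul3, xiC_add_smul0, xiC_add_smul1, xiC_add_smul2]; omega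
  · simp only [upC_add_smul3, upC_add_smul0, upC_add_smul1, upC_add_smul2]; omega

/-- **The vertices of the four legs of the top route**, with the leg lengths as natural numbers. -/
theorem mem_pathVerts_routeTop_legs (hvs1 : xiC k vs = K) (hvs2 : upC k vs = -K) (hn0 : (n0 : ℤ) = 2 * K)
    (hn1 : (n1 : ℤ) = xiC k p + K) (hn2 : (n2 : ℤ) = K - upC k p)
    (hιfar : ∀ v : Site 2, (xiC k v = K ∨ xiC k v = -K ∨ upC k v = K ∨ upC k v = -K) → ι v = 0)
    (hιsp : ∀ v : Site 2, xiC k v = xiC k p → upC k p + 1 ≤ upC k v → ι v = 0) {v : Site 2}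
    (hv : v ∈ pathVerts vs (List.replicate n0 (k + 2) ++ (List.replicate n0 (k + 1) ++ (List.replicate n1 k ++
      (List.replicate n2 (k + 3) ++ gds))))) :
    (upC k v = -K ∧ -K + 1 ≤ xiC k v ∧ xiC k v ≤ K ∧ ι v = 0) ∨ (xiC k v = -K ∧ -K ≤ upC k v ∧ upC k v ≤ K - 1 ∧ ι v = 0) ∨
      (upC k v = K ∧ -K ≤ xiC k v ∧ xiC k v ≤ xiC k p - 1 ∧ ι v = 0) ∨
      (xiC k v = xiC k p ∧ upC k p + 1 ≤ upC k v ∧ upC k v ≤ K ∧ ι v = 0) ∨ v ∈ pathVerts p gds := by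
  rw [mem_pathVerts_replicate_append, mem_pathVerts_replicate_append, mem_pathVerts_replicate_append,
    mem_pathVerts_replicate_append, routeTop_corner_eq hvs1 hvs2 hn0 hn1 hn2] at hv
  rcases hv with ⟨i, hi, h⟩ | ⟨i, hi, h⟩ | ⟨i, hi, h⟩ | ⟨i, hi, h⟩ | h
  · left
    have hx := congrArg (xiC k) h
    have hy := congrArg (upC k) h
    simp only [xiC_add_smul2, upC_add_smul2] at hx hy
    exact ⟨by omega, by omega, by omega, hιfar v (by omega)⟩
  · right; left
    have hx := congrArg (xiC k) h
    have hy := congrArg (upC k) h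
    simp only [xiC_add_smul1, xiC_add_smul2, upC_add_smul1, upC_add_smul2] at hx hy
    exact ⟨by omega, by omega, by omega, hιfar v (by omega)⟩
  · right; right; left
    have hx := congrArg (xiC k) h
    have hy := congrArg (upC k) h
    simp only [xiC_add_smul0, xiC_add_smul1, xiC_add_smul2, upC_add_smul0, upC_add_smul1, upC_add_smul2] at hx hy
    exact ⟨by omega, by omega, by omega, hιfar v (by omega)⟩
  · right; right; right; left
    have hx := congrArg (xiC k) h
    have hy := congrArg (upC k) h
    simp only [xiC_add_smul3, xiC_add_smul0, xiC_add_smul1, xiC_add_smul2, upC_add_smul3, upC_add_smul0, upC_add_smul1,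
      upC_add_smul2] at hx hy
    exact ⟨by omega, by omega, by omega, hιsp v (by omega) (by omega)⟩
  · exact Or.inr (Or.inr (Or.inr (Or.inr h)))

/-- **The four legs of the top route and the gadget have no repeated vertex.** -/
theorem nodup_pathVerts_routeTop_legs (hvs1 : xiC k vs = K) (hvs2 : upC k vs = -K) (hn0 : (n0 : ℤ) = 2 * K)
    (hn1 : (n1 : ℤ) = xiC k p + K) (hn2 : (n2 : ℤ) = K - upC k p) (hp1 : |xiC k p| ≤ K - 2) (hp2 : |upC k p| ≤ K - 2)
    (hgV : ∀ v ∈ pathVerts p gds, v = p ∨ (ι v = 1 ∧ |xiC k v - xiC k p| ≤ 1 ∧ |upC k v - upC k p| ≤ 1))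
    (hgnd : (pathVerts p gds).Nodup)
    (hιfar : ∀ v : Site 2, (xiC k v = K ∨ xiC k v = -K ∨ upC k v = K ∨ upC k v = -K) → ι v = 0)
    (hιsp : ∀ v : Site 2, xiC k v = xiC k p → upC k p + 1 ≤ upC k v → ι v = 0) :
    (pathVerts vs (List.replicate n0 (k + 2) ++ (List.replicate n0 (k + 1) ++ (List.replicate n1 k ++
      (List.replicate n2 (k + 3) ++ gds))))).Nodup := by
  rw [abs_le] at hp1 hp2
  have hgV' : ∀ v ∈ pathVerts p gds, (xiC k v = xiC k p ∧ upC k v = upC k p) ∨ ι v = 1 := fun v hv => by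
    rcases hgV v hv with rfl | h
    · exact Or.inl ⟨rfl, rfl⟩
    · exact Or.inr h.1
  -- the corners
  obtain ⟨c1, hc1⟩ : ∃ c1 : Site 2, c1 = vs + (n0 : ℤ) • cornerUnit (k + 2) := ⟨_, rfl⟩
  obtain ⟨c2, hc2⟩ : ∃ c2 : Site 2, c2 = c1 + (n0 : ℤ) • cornerUnit (k + 1) := ⟨_, rfl⟩
  obtain ⟨c3, hc3⟩ : ∃ c3 : Site 2, c3 = c2 + (n1 : ℤ) • cornerUnit k := ⟨_, rfl⟩
  have hc1x : xiC k c1 = -K := by rw [hc1, xiC_add_smul2]; omega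
  have hc1y : upC k c1 = -K := by rw [hc1, upC_add_smul2]; omega
  have hc2x : xiC k c2 = -K := by rw [hc2, xiC_add_smul1]; omega
  have hc2y : upC k c2 = K := by rw [hc2, upC_add_smul1]; omega
  have hc3x : xiC k c3 = xiC k p := by rw [hc3, xiC_add_smul0]; omega
  have hc3y : upC k c3 = K := by rw [hc3, upC_add_smul0]; omega
  have hc4 : c3 + (n2 : ℤ) • cornerUnit (k + 3) = p := by
    rw [hc3, hc2, hc1]; exact routeTop_corner_eq hvs1 hvs2 hn0 hn1 hn2
  -- membership in the tails
  have hT3 : ∀ v ∈ pathVerts c3 (List.replicate n2 (k + 3) ++ gds),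
      (xiC k v = xiC k p ∧ upC k p + 1 ≤ upC k v ∧ upC k v ≤ K) ∨ (xiC k v = xiC k p ∧ upC k v = upC k p) ∨ ι v = 1 := by
    intro v hv
    rw [mem_pathVerts_replicate_append, hc4] at hv
    rcases hv with ⟨i, hi, h⟩ | h
    · left
      have hx := congrArg (xiC k) h
      have hy := congrArg (upC k) h
      rw [xiC_add_smul3, hc3x] at hx
      rw [upC_add_smul3, hc3y] at hy
      omega
    · exact Or.inr (hgV' v h)
  have hT2 : ∀ v ∈ pathVerts c2 (List.replicate n1 k ++ (List.replicate n2 (k + 3) ++ gds)),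
      (upC k v = K ∧ -K ≤ xiC k v ∧ xiC k v ≤ xiC k p - 1) ∨ (xiC k v = xiC k p ∧ upC k p + 1 ≤ upC k v ∧ upC k v ≤ K) ∨
        (xiC k v = xiC k p ∧ upC k v = upC k p) ∨ ι v = 1 := by
    intro v hv
    rw [mem_pathVerts_replicate_append, ← hc3] at hv
    rcases hv with ⟨i, hi, h⟩ | h
    · left
      have hx := congrArg (xiC k) h
      have hy := congrArg (upC k) h
      rw [xiC_add_smul0, hc2x] at hx
      rw [upC_add_smul0, hc2y] at hy
      omega
    · exact Or.inr (hT3 v h)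
  have hT1 : ∀ v ∈ pathVerts c1 (List.replicate n0 (k + 1) ++ (List.replicate n1 k ++ (List.replicate n2 (k + 3) ++ gds))),
      (xiC k v = -K ∧ -K ≤ upC k v ∧ upC k v ≤ K - 1) ∨ (upC k v = K ∧ -K ≤ xiC k v ∧ xiC k v ≤ xiC k p - 1) ∨
        (xiC k v = xiC k p ∧ upC k p + 1 ≤ upC k v ∧ upC k v ≤ K) ∨ (xiC k v = xiC k p ∧ upC k v = upC k p) ∨ ι v = 1 := by
    intro v hv
    rw [mem_pathVerts_replicate_append, ← hc2] at hv
    rcases hv with ⟨i, hi, h⟩ | h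
    · left
      have hx := congrArg (xiC k) h
      have hy := congrArg (upC k) h
      rw [xiC_add_smul1, hc1x] at hx
      rw [upC_add_smul1, hc1y] at hy
      omega
    · exact Or.inr (hT2 v h)
  -- peel the legs
  rw [nodup_pathVerts_replicate_append, ← hc1]
  refine ⟨?_, fun v hv ⟨i, hi, h⟩ => ?_⟩
  · rw [nodup_pathVerts_replicate_append, ← hc2]
    refine ⟨?_, fun v hv ⟨i, hi, h⟩ => ?_⟩
    · rw [nodup_pathVerts_replicate_append, ← hc3]
      refine ⟨?_, fun v hv ⟨i, hi, h⟩ => ?_⟩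
      · rw [nodup_pathVerts_replicate_append, hc4]
        refine ⟨hgnd, fun v hv ⟨i, hi, h⟩ => ?_⟩
        have hx := congrArg (xiC k) h
        have hy := congrArg (upC k) h
        rw [xiC_add_smul3, hc3x] at hx
        rw [upC_add_smul3, hc3y] at hy
        rcases hgV' v hv with ⟨h1, h2⟩ | hι
        · omega
        · have := hιsp v (by omega) (by omega); omega
      · have hx := congrArg (xiC k) h
        have hy := congrArg (upC k) h
        rw [xiC_add_smul0, hc2x] at hx
        rw [upC_add_smul0, hc2y] at hy
        rcases hT3 v hv with h' | h' | hι
        · omega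
        · omega
        · have := hιfar v (by omega); omega
    · have hx := congrArg (xiC k) h
      have hy := congrArg (upC k) h
      rw [xiC_add_smul1, hc1x] at hx
      rw [upC_add_smul1, hc1y] at hy
      rcases hT2 v hv with h' | h' | h' | hι
      · omega
      · omega
      · omega
      · have := hιfar v (by omega); omega
  · have hx := congrArg (xiC k) h
    have hy := congrArg (upC k) h
    rw [hc1] at hv
    rw [xiC_add_smul2, hvs1] at hx
    rw [upC_add_smul2, hvs2] at hy
    rcases hT1 v (by rwa [hc1]) with h' | h' | h' | h' | hι
    · omega
    · omega
    · omega
    · omega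
    · have := hιfar v (by omega); omega

end Legs

/-- **The top route.** See the module docstring. -/
theorem routeTop_data : ∀ (k : Fin 4) (K : ℤ) (ι : Site 2 → ℤ) (vs p : Site 2) (gds : List (Fin 4)), xiC k vs = K → upC k vs = -K → |xiC k p| ≤ K - 2 → |upC k p| ≤ K - 2 → gds ≠ [] → (∀ v ∈ pathVerts p gds, v = p ∨ (ι v = 1 ∧ |xiC k v - xiC k p| ≤ 1 ∧ |upC k v - upC k p| ≤ 1)) → (pathVerts p gds).Nodup → ι p = 0 → (∀ v : Site 2, (xiC k v = K ∨ xiC k v = -K ∨ upC k v = K ∨ upC k v = -K) → ι v = 0) → (∀ v : Site 2, xiC k v = xiC k p → upC k p + 1 ≤ upC k v → ι v = 0) → ι (pathEnd p gds) = 1 → pathEnd p gds ∉ pathVerts p gds → ∃ Qt : List (Fin 4), routeTop k K p gds = (k + 2) :: Qt ∧ pathEnd vs (routeTop k K p gds) = pathEnd p gds ∧ lastDir (routeTop k K p gds) = lastDir gds ∧ (∀ v ∈ pathVerts vs (routeTop k K p gds), (upC k v = -K ∧ -K + 1 ≤ xiC k v ∧ xiC k v ≤ K ∧ ι v = 0)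 ∨ (xiC k v = -K ∧ -K ≤ upC k v ∧ upC k v ≤ K - 1 ∧ ι v = 0) ∨ (upC k v = K ∧ -K ≤ xiC k v ∧ xiC k v ≤ xiC k p - 1 ∧ ι v = 0) ∨ (xiC k v = xiC k p ∧ upC k p + 1 ≤ upC k v ∧ upC k v ≤ K ∧ ι v = 0) ∨ v ∈ pathVerts p gds) ∧ (pathVerts vs (routeTop k K p gds)).Nodup ∧ pathEnd p gds ∉ pathVerts vs (routeTop k K p gds) ∧ (∀ b ∈ pathVerts vs (routeTop k K p gds), b = vs ∨ xiC k b - upC k b ≤ 2 * K - 1) := by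
  intro k K ι vs p gds hvs1 hvs2 hp1 hp2 hgds hgV hgnd hιp hιfar hιsp hx1 hx2
  have hp1' := hp1
  have hp2' := hp2
  rw [abs_le] at hp1 hp2
  -- leg lengths as natural numbers
  obtain ⟨n0, hn0, hr0⟩ : ∃ n0 : ℕ, (n0 : ℤ) = 2 * K ∧ (2 * K).toNat = n0 := ⟨_, Int.toNat_of_nonneg (by omega), rfl⟩
  obtain ⟨n1, hn1, hr1⟩ : ∃ n1 : ℕ, (n1 : ℤ) = xiC k p + K ∧ (xiC k p + K).toNat = n1 :=
    ⟨_, Int.toNat_of_nonneg (by omega), rfl⟩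
  obtain ⟨n2, hn2, hr2⟩ : ∃ n2 : ℕ, (n2 : ℤ) = K - upC k p ∧ (K - upC k p).toNat = n2 :=
    ⟨_, Int.toNat_of_nonneg (by omega), rfl⟩
  have hroute : routeTop k K p gds = List.replicate n0 (k + 2) ++ (List.replicate n0 (k + 1) ++
      (List.replicate n1 k ++ (List.replicate n2 (k + 3) ++ gds))) := by
    simp only [routeTop, List.append_assoc, hr0, hr1, hr2]
  have hverts := fun v (hv : v ∈ pathVerts vs (routeTop k K p gds)) =>
    mem_pathVerts_routeTop_legs (gds := gds) hvs1 hvs2 hn0 hn1 hn2 hιfar hιsp (hroute ▸ hv)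
  refine ⟨List.replicate (n0 - 1) (k + 2) ++ (List.replicate n0 (k + 1) ++ (List.replicate n1 k ++
    (List.replicate n2 (k + 3) ++ gds))), ?_, ?_, ?_, hverts, ?_, ?_, ?_⟩
  · -- first step
    obtain ⟨m, rfl⟩ : ∃ m, n0 = m + 1 := ⟨n0 - 1, by omega⟩
    rw [hroute, List.replicate_succ, Nat.add_sub_cancel]
    rfl
  · -- end vertex
    rw [hroute, pathEnd_replicate_append, pathEnd_replicate_append, pathEnd_replicate_append, pathEnd_replicate_append,
      routeTop_corner_eq hvs1 hvs2 hn0 hn1 hn2]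
  · -- last direction
    rw [hroute, lastDir_append_of_ne_nil, lastDir_append_of_ne_nil, lastDir_append_of_ne_nil, lastDir_append_of_ne_nil _ hgds]
    · exact List.append_ne_nil_of_right_ne_nil _ hgds
    · exact List.append_ne_nil_of_right_ne_nil _ (List.append_ne_nil_of_right_ne_nil _ hgds)
    · exact List.append_ne_nil_of_right_ne_nil _
        (List.append_ne_nil_of_right_ne_nil _ (List.append_ne_nil_of_right_ne_nil _ hgds))
  · -- no repeated vertex
    rw [hroute]
    exact nodup_pathVerts_routeTop_legs hvs1 hvs2 hn0 hn1 hn2 hp1' hp2' hgV hgnd hιfar hιsp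
  · -- the end vertex is new
    intro h
    rcases hverts _ h with ⟨-, -, -, h0⟩ | ⟨-, -, -, h0⟩ | ⟨-, -, -, h0⟩ | ⟨-, -, -, h0⟩ | h0
    · omega
    · omega
    · omega
    · omega
    · exact hx2 h0
  · -- the side functional off the far corner
    intro b hb
    rcases hverts b hb with ⟨h1, h2, h3, -⟩ | ⟨h1, h2, h3, -⟩ | ⟨h1, h2, h3, -⟩ | ⟨h1, h2, h3, -⟩ | h
    · rcases lt_or_eq_of_le h3 with h3 | h3
      · right; omega
      · left; exact eq_of_xiC_upC (k := k) (by omega) (by omega)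
    · right; omega
    · right; omega
    · right; omega
    · rcases hgV b h with rfl | ⟨-, h4, h5⟩
      · right; omega
      · rw [abs_le] at h4 h5; right; omega

end Summit.CriticalPhenomena.CardyFormulaZ2.Cruxes.ParafermionToSLESixFamilies.PotentialDarbouxPicardDiamond

end
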